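import Literature.NumberTheory.EllipticCurves.LocalKummerMap
import Literature.NumberTheory.EllipticCurves.LocalTorsionCohomologyCoprime
import HarnessLib

/-!
# HT-C4 (c): level-raising kills Kummer classes at a place `ℓ ∤ p`

Seat `bsd-2adic-t42` GEN 40 (hand h6 = HT-C4 of LEAD ss-1 GEN 21, `HAND-TARGETS-CDC-2.md` §2, scratch
`HANDTARGETS_CDC2_GEN21.lean` :92; crux 19097 `SupersingularRankZeroAtTwo`, line `odd_blind_package`, slot 5 CDC_H —
`--supports stmt-BirchSwinnertonDyer-19097 --as helper`). THEOREMS ONLY (no definition, no named fact, no `sorry`).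
`c`-generic, `W`-generic, `p`-generic: nothing here sees the multiplier, the colour, `W₂` or `p = 2`.

## What

For an elliptic curve `W/ℚ`, a prime `p`, a finite place `ℓ ∤ p`, an exponent `e` with `p^e · W(ℚ_ℓ)[p^∞] = 0`, and levels
`J' + e ≤ J`, the level-raising map `H¹(ι) : H¹(ℚ_ℓ, W[p^{J'}]) → H¹(ℚ_ℓ, W[p^J])` (`ι = torsionInclusion`, `p^{J'} ∣ p^J`)
KILLS the local Kummer condition `𝓛_ℓ = im κ_ℓ ≤ H¹(ℚ_ℓ, W[p^{J'}])`:

* §1 `exists_pow_smul_eq_pow_smul_adicCompletion` — the local algebra at `ℓ ≠ p`: **`p^m · W(ℚ_ℓ) ⊆ p^J · W(ℚ_ℓ)` as soon as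
  `m, J ≥ e`**. Proof by counting: `#(W(ℚ_ℓ)/p^k) = #H¹(ℚ_ℓ, W)[p^k] = #W(ℚ_ℓ)[p^k]` (Tate local duality / Milne I Lemma 3.3
  at `ℓ ∤ p`, tree `natCard_torsionBy_galoisCohomology_localGaloisModule_eq_{card_quotient_,}of_not_mem`), and
  `W(ℚ_ℓ)[p^k] = W(ℚ_ℓ)[p^e]` for `k ≥ e`; so the finite indices `[W(ℚ_ℓ) : p^k W(ℚ_ℓ)]` agree for all `k ≥ e`, and the nested
  subgroups `p^k W(ℚ_ℓ) ≤ p^e W(ℚ_ℓ)` coincide (`relIndex = 1`).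
* §2 ★ `HTC4_map_torsionInclusion_kummerLocalConditionAt_eq_bot` — the hand, signature VERBATIM: a Kummer class is
  `κ_{J'}(P) = [σ ↦ σQ − Q]` with `p^{J'} Q = P ∈ W(ℚ_ℓ)` (tree `range_localKummerMap`); `H¹(ι) κ_{J'}(Q) = κ_J(Q)` (same
  cocycle, tree `map_torsionInclusion_localKummerClass`), and `κ_J(Q)` only depends on `p^J Q = p^{J−J'} P = p^J R` with
  `R ∈ W(ℚ_ℓ)` (§1), so it is `localKummerMap (p^J R) = 0` (tree `ker_localKummerMap`: the kernel of the Kummer map is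
  `p^J W(ℚ_ℓ)`).

HONEST FRAMING: functoriality of the local Kummer sequence; nothing about any summit is asserted; closes no item; 19097 stays
OPEN; BSD is proved for no curve by any of this; typed ≠ proved.

References: [MilneADT2006] I §3 Lemma 3.3, Thm. 3.2 / Cor. 3.4, Rem. 3.6; [SilvermanAEC2009] Prop. VII.6.3, VIII §2 (Kummer
sequence and its functoriality), X.§4 diagram (**).
-/

set_option autoImplicit false
set_option linter.dupNamespace false -- the summit and its single problem are both `BirchSwinnertonDyer` (D-0017 layout)

noncomputable section

open scoped Classical NumberField

namespace Summit.BirchSwinnertonDyer.BirchSwinnertonDyer.Theorems.FlatBlindLevelPassage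

open NumberField IsDedekindDomain Field WeierstrassCurve Literature.NumberTheory.EllipticCurves
  Literature.NumberTheory.GaloisRepresentations

/-! ## §1 The local algebra at `ℓ ≠ p`: `p^m W(ℚ_ℓ) ⊆ p^J W(ℚ_ℓ)` for `m, J ≥ e` -/

section LocalAlgebra

variable {K : Type} [Field K] [NumberField K] (W : WeierstrassCurve K) [W.IsElliptic] (p : ℕ) [hp : Fact p.Prime]
  (ℓ : HeightOneSpectrum (𝓞 K))

omit [NumberField K] hp in
/-- `p^k ∉ ℓ` when `p ∉ ℓ` (the ideal of a finite place is prime). [folklore] -/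
theorem pow_natCast_not_mem (hℓ : ((p : ℕ) : 𝓞 K) ∉ ℓ.asIdeal) (k : ℕ) :
    ((p ^ k : ℕ) : 𝓞 K) ∉ ℓ.asIdeal := by
  rw [Nat.cast_pow]
  exact fun h ↦ hℓ (ℓ.isPrime.mem_of_pow_mem k h)

/-- **`[W(K_ℓ) : p^k W(K_ℓ)] = #W(K_ℓ)[p^k]` at a place `ℓ ∤ p`** (Milne I Lemma 3.3 with `(𝓞_ℓ : p^k 𝓞_ℓ) = 1`, through the
tree's unconditional Tate-duality counts `#H¹(K_ℓ, W)[n] = #W(K_ℓ)[n] = #(W(K_ℓ)/n)` at `ℓ ∤ n`).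
[cite: MilneADT2006, I Lemma 3.3 and Thm. 3.2] -/
theorem index_range_nsmul_eq_natCard_ker_of_not_mem (hℓ : ((p : ℕ) : 𝓞 K) ∉ ℓ.asIdeal) (k : ℕ) :
    (nsmulAddMonoidHom (p ^ k) : (W.baseChange (ℓ.adicCompletion K)).toAffine.Point →+ _).range.index =
      Nat.card (nsmulAddMonoidHom (p ^ k) : (W.baseChange (ℓ.adicCompletion K)).toAffine.Point →+ _).ker := by
  haveI : NeZero (p ^ k) := ⟨pow_ne_zero k hp.out.ne_zero⟩
  rw [AddSubgroup.index,
    ← natCard_torsionBy_galoisCohomology_localGaloisModule_eq_card_quotient_of_not_mem W ℓ (p ^ k)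
      (pow_natCast_not_mem p ℓ hℓ k),
    natCard_torsionBy_galoisCohomology_localGaloisModule_eq_of_not_mem W ℓ (p ^ k) (pow_natCast_not_mem p ℓ hℓ k)]

/-- **`p^k W(K_ℓ) = p^e W(K_ℓ)` for `k ≥ e` at `ℓ ∤ p`, when `p^e` kills `W(K_ℓ)[p^∞]`**: the two subgroups are nested, of the
same finite index (`#W(K_ℓ)[p^k] = #W(K_ℓ)[p^e]`). [cite: MilneADT2006, I Lemma 3.3 and Rem. 3.6] [cite: SilvermanAEC2009, Prop. VII.6.3] -/
theorem range_nsmul_pow_eq_of_le (hℓ : ((p : ℕ) : 𝓞 K) ∉ ℓ.asIdeal) (e : ℕ)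
    (he : ∀ P : (W.baseChange (ℓ.adicCompletion K)).toAffine.Point, (∃ k : ℕ, p ^ k • P = 0) → p ^ e • P = 0)
    {k : ℕ} (hk : e ≤ k) :
    (nsmulAddMonoidHom (p ^ k) : (W.baseChange (ℓ.adicCompletion K)).toAffine.Point →+ _).range =
      (nsmulAddMonoidHom (p ^ e) : (W.baseChange (ℓ.adicCompletion K)).toAffine.Point →+ _).range := by
  set A := (W.baseChange (ℓ.adicCompletion K)).toAffine.Point
  -- the kernels agree
  have hker : (nsmulAddMonoidHom (p ^ k) : A →+ A).ker = (nsmulAddMonoidHom (p ^ e) : A →+ A).ker := by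
    ext P
    simp only [AddMonoidHom.mem_ker, nsmulAddMonoidHom_apply]
    constructor
    · exact fun h ↦ he P ⟨k, h⟩
    · intro h
      obtain ⟨d, rfl⟩ := Nat.exists_eq_add_of_le hk
      rw [pow_add, mul_comm, mul_smul, h, smul_zero]
  -- nested
  have hle : (nsmulAddMonoidHom (p ^ k) : A →+ A).range ≤ (nsmulAddMonoidHom (p ^ e) : A →+ A).range := by
    rintro _ ⟨P, rfl⟩
    obtain ⟨d, rfl⟩ := Nat.exists_eq_add_of_le hk
    exact ⟨p ^ d • P, by rw [nsmulAddMonoidHom_apply, nsmulAddMonoidHom_apply, ← mul_smul, ← pow_add]⟩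
  -- same finite index
  have hidx : (nsmulAddMonoidHom (p ^ k) : A →+ A).range.index = (nsmulAddMonoidHom (p ^ e) : A →+ A).range.index := by
    rw [index_range_nsmul_eq_natCard_ker_of_not_mem W p ℓ hℓ k,
      index_range_nsmul_eq_natCard_ker_of_not_mem W p ℓ hℓ e, hker]
  have hne : (nsmulAddMonoidHom (p ^ e) : A →+ A).range.index ≠ 0 := by
    rw [index_range_nsmul_eq_natCard_ker_of_not_mem W p ℓ hℓ e]
    haveI := W.finite_ker_nsmul_adicCompletion ℓ (pow_ne_zero e hp.out.ne_zero)
    exact Nat.card_pos.ne'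
  refine le_antisymm hle ?_
  have h := AddSubgroup.relIndex_mul_index hle
  rw [hidx] at h
  have h1 : ((nsmulAddMonoidHom (p ^ k) : A →+ A).range).relIndex (nsmulAddMonoidHom (p ^ e) : A →+ A).range = 1 :=
    (Nat.mul_eq_right hne).mp h
  exact AddSubgroup.relIndex_eq_one.mp h1

/-- **The local algebra at `ℓ ≠ p`**: if `p^e` kills `W(K_ℓ)[p^∞]` and `m, J ≥ e`, then for every `P ∈ W(K_ℓ)` there is
`R ∈ W(K_ℓ)` with `p^m P = p^J R` (`W(K_ℓ) ≅ ℤ_ℓ^a × finite`, the pro-`ℓ` part being uniquely `p`-divisible).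
[cite: MilneADT2006, I Lemma 3.3 and Rem. 3.6] [cite: SilvermanAEC2009, Prop. VII.6.3] -/
theorem exists_pow_smul_eq_pow_smul_adicCompletion (hℓ : ((p : ℕ) : 𝓞 K) ∉ ℓ.asIdeal) (e : ℕ)
    (he : ∀ P : (W.baseChange (ℓ.adicCompletion K)).toAffine.Point, (∃ k : ℕ, p ^ k • P = 0) → p ^ e • P = 0)
    {m J : ℕ} (hm : e ≤ m) (hJ : e ≤ J) (P : (W.baseChange (ℓ.adicCompletion K)).toAffine.Point) :
    ∃ R : (W.baseChange (ℓ.adicCompletion K)).toAffine.Point, p ^ m • P = p ^ J • R := by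
  have hmem : p ^ m • P ∈ (nsmulAddMonoidHom (p ^ J) : (W.baseChange (ℓ.adicCompletion K)).toAffine.Point →+ _).range := by
    rw [range_nsmul_pow_eq_of_le W p ℓ hℓ e he hJ, ← range_nsmul_pow_eq_of_le W p ℓ hℓ e he hm]
    exact ⟨P, rfl⟩
  obtain ⟨R, hR⟩ := hmem
  exact ⟨R, hR.symm⟩

omit hp in
/-- `im (localKummerMap) = 𝓛_{K_ℓ}` at a completion of a number field (the tree's `range_localKummerMap`, with the
`CharZero (K_ℓ)` instance supplied here, generically in `K`, so that no `ℚ`-algebra diamond arises downstream).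
[cite: SilvermanAEC2009, X.§4 diagram (**)] -/
theorem range_localKummerMap_adicCompletion {n : ℤ} (hn : n ≠ 0) :
    (W.localKummerMap (ℓ.adicCompletion K) hn).range = W.kummerLocalConditionAt n (ℓ.adicCompletion K) := by
  haveI : CharZero (ℓ.adicCompletion K) := charZero_adicCompletion ℓ
  exact W.range_localKummerMap (ℓ.adicCompletion K) hn

omit hp in
/-- `ker (localKummerMap) = n · W(K_ℓ)` at a completion of a number field (the tree's `ker_localKummerMap`, `CharZero`
supplied generically in `K`). [cite: SilvermanAEC2009, VIII §2 (exactness of the Kummer sequence at E(K)/mE(K))] -/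
theorem ker_localKummerMap_adicCompletion {n : ℤ} (hn : n ≠ 0) :
    (W.localKummerMap (ℓ.adicCompletion K) hn).ker =
      (zsmulAddGroupHom n : (W.baseChange (ℓ.adicCompletion K)).toAffine.Point →+ _).range := by
  haveI : CharZero (ℓ.adicCompletion K) := charZero_adicCompletion ℓ
  exact W.ker_localKummerMap (ℓ.adicCompletion K) hn

end LocalAlgebra

/-! ## §2 ★ HT-C4 (c): `H¹(ι)` kills the Kummer condition of level `J'` at level `J ≥ J' + e` -/

section Hand

/-- **HT-C4(c) = h6, part (c) (LEVEL-RAISING KILLS KUMMER CLASSES at `ℓ ∤ p`) — hand of LEAD ss-1 GEN 21, signature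
verbatim.** For `W/ℚ` elliptic, `p`, a finite place `ℓ ∤ p`, an exponent `e` with `p^e · W(ℚ_ℓ)[p^∞] = 0` (any
`e ≥ v_p #W(ℚ_ℓ)_{tors}`), and levels `J' + e ≤ J`: the level-raising map
`H¹(ι) : H¹(ℚ_ℓ, W[p^{J'}]) → H¹(ℚ_ℓ, W[p^{J}])` (`ι = torsionInclusion`) KILLS the Kummer condition
`im κ_ℓ ⊆ H¹(ℚ_ℓ, W[p^{J'}])`: `H¹(ι) ∘ δ_{J'} = δ_J ∘ [p^{J−J'}]` and `p^{J−J'} W(ℚ_ℓ) ⊆ p^{J} W(ℚ_ℓ)` since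
`W(ℚ_ℓ) ≅ ℤ_ℓ^{a} × finite` with `ℓ ≠ p` (§1). Used with `J'` = exponent of a FIXED finite Selmer group to make its Kummer
localisations at the odd bad primes vanish at level `J` (the Tamagawa-splitting surjectivity, CDC road step 4).
[cite: MilneADT2006, I §3 Lemma 3.3 and Rem. 3.6 (E(K_v) for v ∤ p)] [cite: SilvermanAEC2009, VII.6.3, VIII §2 (Kummer sequence functoriality)] -/
theorem HTC4_map_torsionInclusion_kummerLocalConditionAt_eq_bot (W : WeierstrassCurve ℚ) [W.IsElliptic] (p : ℕ)
    [Fact p.Prime] (ℓ : HeightOneSpectrum (𝓞 ℚ)) (hℓ : ((p : ℕ) : 𝓞 ℚ) ∉ ℓ.asIdeal) (e : ℕ)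
    (he : ∀ P : (W.baseChange (ℓ.adicCompletion ℚ)).toAffine.Point, (∃ k : ℕ, p ^ k • P = 0) → p ^ e • P = 0)
    {J' J : ℕ} (hJ : J' + e ≤ J) :
    (W.kummerLocalConditionAt ((p ^ J' : ℕ) : ℤ) (ℓ.adicCompletion ℚ)).map
        (galoisCohomology.map ((W.torsionInclusion (d := ((p ^ J' : ℕ) : ℤ)) (N := ((p ^ J : ℕ) : ℤ))
          (Int.natCast_dvd_natCast.mpr (Nat.pow_dvd_pow p (by omega)))).restrictField (ℓ.adicCompletion ℚ)) 1) = ⊥ := by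
  have hp : p.Prime := Fact.out
  have hd : ((p ^ J' : ℕ) : ℤ) ≠ 0 := by exact_mod_cast pow_ne_zero J' hp.ne_zero
  have hN : ((p ^ J : ℕ) : ℤ) ≠ 0 := by exact_mod_cast pow_ne_zero J hp.ne_zero
  rw [eq_bot_iff]
  rintro _ ⟨c, hc, rfl⟩
  rw [AddSubgroup.mem_bot]
  -- `c = κ_{J'}(P)` for a point `P ∈ W(ℚ_ℓ)`
  have hc' : c ∈ (W.localKummerMap (ℓ.adicCompletion ℚ) hd).range := by
    rw [range_localKummerMap_adicCompletion W ℓ hd]; exact hc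
  obtain ⟨P, rfl⟩ := hc'
  -- the local algebra: `p^{J-J'} P = p^J R`
  obtain ⟨R, hR⟩ := exists_pow_smul_eq_pow_smul_adicCompletion W p ℓ hℓ e he (m := J - J') (J := J)
    (by omega) (by omega) P
  -- a root `Q` of `P` at level `p^{J'}`
  set Q := W.localZSMulRoot (ℓ.adicCompletion ℚ) hd P with hQdef
  have hQ := W.zsmul_localZSMulRoot (ℓ.adicCompletion ℚ) hd P
  have hQfix := W.zsmul_mem_fixedPoints_of_eq (ℓ.adicCompletion ℚ) hQ
  -- `p^J Q = e(p^J R)`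
  have hQ' : ((p ^ J : ℕ) : ℤ) • Q =
      W.baseChangeGeomPointsEquiv (ℓ.adicCompletion ℚ)
        (toGeomPoints (W.baseChange (ℓ.adicCompletion ℚ)) (((p ^ J : ℕ) : ℤ) • R)) := by
    have hpow : ((p ^ J : ℕ) : ℤ) = ((p ^ (J - J') : ℕ) : ℤ) * ((p ^ J' : ℕ) : ℤ) := by
      rw [← Nat.cast_mul, ← pow_add]
      congr 2
      omega
    calc ((p ^ J : ℕ) : ℤ) • Q = ((p ^ (J - J') : ℕ) : ℤ) • (((p ^ J' : ℕ) : ℤ) • Q) := by rw [hpow, mul_smul]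
      _ = W.baseChangeGeomPointsEquiv (ℓ.adicCompletion ℚ)
            (toGeomPoints (W.baseChange (ℓ.adicCompletion ℚ)) (((p ^ (J - J') : ℕ) : ℤ) • P)) := by
          rw [hQ, ← map_zsmul, ← map_zsmul]
      _ = W.baseChangeGeomPointsEquiv (ℓ.adicCompletion ℚ)
            (toGeomPoints (W.baseChange (ℓ.adicCompletion ℚ)) (((p ^ J : ℕ) : ℤ) • R)) := by
          rw [natCast_zsmul, hR, natCast_zsmul]
  have hQ'fix := W.zsmul_mem_fixedPoints_of_eq (ℓ.adicCompletion ℚ) hQ'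
  rw [W.localKummerMap_eq_localKummerClass (ℓ.adicCompletion ℚ) hd P Q hQfix hQ,
    W.map_torsionInclusion_localKummerClass _ hd hN Q hQfix hQ'fix,
    ← W.localKummerMap_eq_localKummerClass (ℓ.adicCompletion ℚ) hN (((p ^ J : ℕ) : ℤ) • R) Q hQ'fix hQ']
  -- `localKummerMap (p^J R) = 0`
  have hker : ((p ^ J : ℕ) : ℤ) • R ∈ (W.localKummerMap (ℓ.adicCompletion ℚ) hN).ker := by
    rw [ker_localKummerMap_adicCompletion W ℓ hN]
    exact ⟨R, rfl⟩
  exact hker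

end Hand

end Summit.BirchSwinnertonDyer.BirchSwinnertonDyer.Theorems.FlatBlindLevelPassage

end
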